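import Summits.ABC.IUTFork.Cor312Ind2BallsRamified
import Literature.IUT.LogVolume.LatticeAutOrbits
import Literature.IUT.LogVolume.AdaptedBasis
import Literature.IUT.LogThetaLattice.HolomorphicLogShellUnramified
import HarnessLib

/-!
# [IUTchIII] Cor. 3.12 support — at a TAME RAMIFIED place the typed (Ind2) group `Real.ismDH` contains a LATTICE
# SHEAR carrying any `s` with `‖p‖ ≤ ‖s‖ < 1` to any `t` with `‖p‖ ≤ ‖t‖ < 1`, while NOT shrinking `1`

PROOF-ONLY kernel piece of the abc-iut cell (Cor. 3.12 sub-crew, L-DH lane, seat abc-iut-c312-3, gen 6; item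
«Cor312Ind2ShearRamified» = the ENGINE of the lineage's note «LicenceShallowRamified», HOME/STATUS 2026-08-26T08:51:10Z).
TAKES NO SIDE on [IUTchIII] Cor. 3.12; no definition, no `Prop` fact.

In abc-iut-c312-5's real setting of record the (Ind2) slot at a finite place `v` is `Real.ismDH logv (inr v)` = ALL
bicontinuous `ℚ`-linear automorphisms of `K_v` mapping the log-shell `I_v = (p^*)⁻¹·log_v(𝒪_v^×)` onto itself —
Dupuy–Hilado, arXiv:2004.13228 §4.9 "`Aut_{ℚ_p}(K_v : I_v)` … `ℚ_p`-vector space automorphisms which arise as `ℤ_p`-lattice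
isomorphisms of `I_v`", their reading of [IUTchIII] Thm. 3.11 (i) (Ind2) (kurims p. 154 l. 59–60 "Ism"). abc-iut-c312-5 showed
that at a ramified place this group moves balls off the balls (`Cor312Ind2BallsRamified`, campaign-S `LatticeAutBalls`). THIS
FILE gives the CONSTRUCTIVE form such a consumer needs: at a place `v ∣ p` with `p > 2` and absolute ramification index
`e_v ≤ p − 2` (so that, for the analytic logarithm, `log_p(𝒪_v^×) = 𝔪_v = {‖y‖ ≤ ‖ϖ‖}` — tree
`Literature.IUT.LogThetaLattice.logUnits_eq_closedBall_of_absRamificationIdx_le`, [IUTchIV] Prop. 1.2 (i)), for ANY two elements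
`s, t ∈ K_v` with `‖p‖ ≤ ‖s‖ < 1` and `‖p‖ ≤ ‖t‖ < 1`:

* `exists_latticeAut_logUnits_map_eq_of_absRamificationIdx_le` (any ultrametric normed `ℚ_p`-field `K`, `p > 2`, `e ≤ p − 2`):
  there is a `ℚ_p`-linear automorphism `φ` of `K` fixing every scalar multiple `c·log_p(𝒪^×)` (in particular the log-shell)
  with `φ s = t` AND `1 ≤ ‖φ 1‖`. PROOF: `log_p(𝒪^×) = 𝔪` is the lattice of an adapted basis (campaign-S `exists_adaptedBasis`,
  Weil BNT II §2 Th. 1); `s, t ∈ 𝔪 ∖ p·𝔪` are PRIMITIVE (`‖p·y‖ ≤ ‖p‖·‖ϖ‖ < ‖p‖`; tree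
  `PadicModule.primitive_iff_not_mem_p_smul`), and `Aut_{ℤ_p}(𝔪)` acts transitively on primitive vectors (tree
  `PadicModule.exists_latticeAut_map_eq`); finally `φ 1 ∉ 𝔪` because `1 ∉ 𝔪` and `φ` preserves membership in `𝔪`, i.e.
  `‖φ 1‖ ≥ 1` (`𝔪 = {‖y‖ < 1}`).
* **`exists_mem_ismDH_map_eq`** — read on c312-5's carrier `Real.Carrier (inr v) = K_v` (same type as abc-iut-S7's
  `RescaledCompletion F p v hv`; the log-shell is `(p^*)⁻¹ • log_p(𝒪^×)` there, c312-5 `mem_shell_iff_mem_smul_logUnits`), that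
  `φ` IS an element `g ∈ Real.ismDH logv (inr v)` (bicontinuous — finite dimension — and fixing `I_v`) with `g s = t` and
  `1 ≤ ‖g 1‖`;
* **`exists_mem_ismDH_map_pow_eq`** — the pilot-idele form: for `t_q ∈ K_v` with `‖t_q‖ < 1` and `‖p‖ ≤ ‖t_q^N‖` (`1 ≤ N`;
  print: `N = ℓ⋇²`, the top label's exponent, honest Θ-idele `t_{Θ,ℓ⋇,v} = t_{q,v}^{ℓ⋇²}`) some `g ∈ Real.ismDH logv (inr v)`
  has `g (t_q^N) = t_q` and `1 ≤ ‖g 1‖`.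

WHY (the consumer, NOT proved here — recipe for the follow-up «LicenceShallowRamified»): at the sharp real settings
`settingDHVolSharp` / `settingPrVolSharp` the Θ-box at label `j` and tuple `v⃗` is `ι_j(t_{Θ,j,v_j})·(R_I)^∼` and the q-box
`ι_j(t_{q,v_j})·(R_I)^∼`; with `g_v` as above at every bad place (`id` at the others) the (Ind2)-family `Φ = ⊗_a g_{v_a}` maps
the element `x = 1 ⊗ ⋯ ⊗ 1 ⊗ t_{Θ,ℓ⋇,v_j}` of the Θ-box (`t_{Θ,ℓ⋇}/t_{Θ,j}` is integral) to `⊗_{a<j} g_{v_a}(1) ⊗ t_{q,v_j}`, whose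
factor norms are `≥ ‖t_{q,v_j}‖`; the smallest hull-set containing it therefore contains the q-box — the (xi-f) licence at
that packet. So where EVERY bad place is tame with `‖p‖_v ≤ ‖t_{Θ,ℓ⋇,v}‖_v` (honest data over `F_mod = ℚ`: `ℓ⋇²·ord_p(q_E) ≤ 2l`,
i.e. `l = 5` and `ord_p(Δ_E) ≤ 2`, or `l = 7` and `ord_p(Δ_E) = 1`) the hull-level residual `S_H` is INHABITED — the
complement of the deep-packet refutation `Cor312LicenceDeepReal` (abc-iut-w4-d026). HONEST SCOPE: statements about DH's (Ind2)
as typed (`Real.ismDH`; the M-level `Ism` binder of `Thm311Real` is untouched) and about OUR containers; nothing here asserts or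
refutes [IUTchIII] Cor. 3.12 or bears on what any author intended; typed ≠ proved; instantiated ≠ endorsed.
[cite: DupuyHilado2025, §4.9] [cite: WeilBNT1967, Ch. II §2, Th. 1] [cite: Mochizuki2012, IUTchIV Prop. 1.2 (i) p. 10]
[claim: Mochizuki2012, status: disputed] for every IUT quotation.
-/

noncomputable section

open Set Metric NumberField IsDedekindDomain
open scoped Pointwise

namespace Summit.ABC

namespace IUTFork

namespace Thm311

namespace Real

open Cor312Vol Literature.IUT.LogThetaLattice Literature.IUT.LogVolume Literature.NumberTheory.NumberFields
open Literature.NumberTheory.GaloisRepresentations.Ultrametric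

/-! ## 1. The lattice shear in a tame ramified `p`-adic field -/

section General

variable (p : ℕ) [hp : Fact p.Prime]
variable (K : Type*) [NontriviallyNormedField K] [NormedAlgebra ℚ_[p] K] [IsUltrametricDist K] [ProperSpace K]

omit [IsUltrametricDist K] [ProperSpace K] in
/-- `‖(p : ℚ_p) • y‖ = p⁻¹·‖y‖` in a normed `ℚ_p`-algebra. [folklore] -/
theorem norm_natCast_prime_smul (y : K) : ‖((p : ℕ) : ℚ_[p]) • y‖ = (p : ℝ)⁻¹ * ‖y‖ := by
  rw [norm_smul, Padic.norm_p]

omit [IsUltrametricDist K] [ProperSpace K] in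
/-- An element `s` of the lattice `𝔪 = {‖y‖ ≤ ‖ϖ‖}` with `p⁻¹ ≤ ‖s‖` is NOT in `p·𝔪` (`‖p·y‖ ≤ p⁻¹‖ϖ‖ < p⁻¹`): it is a
primitive vector. [cite: WeilBNT1967, Ch. II §2, Th. 1] -/
theorem not_mem_prime_smul_closedBall {ϖ : Kˣ} (hϖ : IsUniformizer ϖ) {s : K} (hs : (p : ℝ)⁻¹ ≤ ‖s‖) :
    s ∉ ((p : ℕ) : ℚ_[p]) • closedBall (0 : K) ‖(ϖ : K)‖ := by
  rintro ⟨y, hy, rfl⟩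
  rw [mem_closedBall_zero_iff] at hy
  have hp0 : (0 : ℝ) < (p : ℝ)⁻¹ := by
    have : (0 : ℝ) < p := by exact_mod_cast hp.out.pos
    positivity
  have h : ‖((p : ℕ) : ℚ_[p]) • y‖ < (p : ℝ)⁻¹ := by
    rw [norm_natCast_prime_smul]
    calc (p : ℝ)⁻¹ * ‖y‖ ≤ (p : ℝ)⁻¹ * ‖(ϖ : K)‖ := mul_le_mul_of_nonneg_left hy hp0.le
      _ < (p : ℝ)⁻¹ * 1 := mul_lt_mul_of_pos_left hϖ.norm_lt_one hp0
      _ = (p : ℝ)⁻¹ := mul_one _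
  exact (not_le.mpr h) hs

/-- **The lattice shear.** In an ultrametric normed `ℚ_p`-field `K` with `p > 2` and `e ≤ p − 2` (so `log_p(𝒪^×) = 𝔪`), for
all `s, t` with `p⁻¹ ≤ ‖s‖ < 1` and `p⁻¹ ≤ ‖t‖ < 1` there is a `ℚ_p`-linear automorphism `φ` of `K` fixing every `c·log_p(𝒪^×)`
(`c ∈ ℚ_p`; in particular the log-shell `(p^*)⁻¹·log_p(𝒪^×)`), with `φ s = t` and `1 ≤ ‖φ 1‖`.
[cite: WeilBNT1967, Ch. II §2, Th. 1] [cite: DupuyHilado2025, §4.9] -/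
theorem exists_latticeAut_logUnits_map_eq_of_absRamificationIdx_le (hp2 : 2 < p)
    (he : absRamificationIdx p K ≤ p - 2) {s t : K} (hs : (p : ℝ)⁻¹ ≤ ‖s‖) (hs1 : ‖s‖ < 1)
    (ht : (p : ℝ)⁻¹ ≤ ‖t‖) (ht1 : ‖t‖ < 1) :
    ∃ φ : K ≃ₗ[ℚ_[p]] K,
      (∀ c : ℚ_[p], φ '' (c • logUnits K) = c • logUnits K) ∧ φ s = t ∧ 1 ≤ ‖φ 1‖ := by
  -- `log_p(𝒪^×)` is the lattice of an adapted basis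
  obtain ⟨n, bZ, b, c, hn, -, hM⟩ := exists_adaptedBasis p (logUnitsAddSubgroup p K)
    (isOpen_logUnits p K) (isCompact_logUnits p K)
  haveI : Nonempty (Fin n) := ⟨⟨0, hn⟩⟩
  set B := b.unitsSMul c with hB
  have hΛ : (logUnits K : Set K) = (PadicModule.basisLattice p B : Set K) := by
    ext x
    rw [hB, ← PadicModule.boxLattice_eq_basisLattice_unitsSMul, SetLike.mem_coe, ← hM x]
    rfl
  -- `log_p(𝒪^×) = 𝔪 = closedBall 0 ‖ϖ‖`
  obtain ⟨ϖ, hϖ⟩ := exists_isUniformizer (F := K)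
  have hball : logUnits K = closedBall (0 : K) ‖(ϖ : K)‖ :=
    logUnits_eq_closedBall_of_absRamificationIdx_le p K hp2 he hϖ
  have hmemΛ : ∀ x : K, x ∈ PadicModule.basisLattice p B ↔ ‖x‖ ≤ ‖(ϖ : K)‖ := fun x => by
    rw [← SetLike.mem_coe, ← hΛ, hball, mem_closedBall_zero_iff]
  -- `s`, `t` are primitive vectors of the lattice
  have hsΛ : s ∈ PadicModule.basisLattice p B := (hmemΛ s).mpr (hϖ.norm_le_of_norm_lt_one s hs1)
  have htΛ : t ∈ PadicModule.basisLattice p B := (hmemΛ t).mpr (hϖ.norm_le_of_norm_lt_one t ht1)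
  have hprim : ∀ x : K, x ∈ PadicModule.basisLattice p B → (p : ℝ)⁻¹ ≤ ‖x‖ → ∃ i, ‖B.repr x i‖ = 1 :=
    fun x hx hpx => by
      rw [PadicModule.primitive_iff_not_mem_p_smul p B hx, ← hΛ, hball]
      exact not_mem_prime_smul_closedBall p K hϖ hpx
  obtain ⟨i, hi⟩ := hprim s hsΛ hs
  obtain ⟨j, hj⟩ := hprim t htΛ ht
  obtain ⟨φ, hφ, hφs⟩ := PadicModule.exists_latticeAut_map_eq p B hsΛ htΛ hi hj
  refine ⟨φ, fun a => ?_, hφs, ?_⟩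
  · rw [hΛ]
    exact PadicModule.image_smul_basisLattice_of_mem p B hφ a
  · -- `φ 1 ∉ 𝔪` since `1 ∉ 𝔪` and `φ` preserves membership in the lattice
    have h1 : (1 : K) ∉ PadicModule.basisLattice p B := fun h => by
      have := (hmemΛ 1).mp h
      rw [norm_one] at this
      exact (not_lt.mpr this) hϖ.norm_lt_one
    have hφ1 : φ 1 ∉ PadicModule.basisLattice p B := fun h =>
      h1 (((PadicModule.mem_latticeAut_basisLattice_iff p B φ).mp hφ 1).mp h)
    rw [hmemΛ, not_le] at hφ1
    by_contra hlt
    rw [not_le] at hlt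
    exact (not_le.mpr hφ1) (hϖ.norm_le_of_norm_lt_one _ hlt)

end General

/-! ## 2. At a tame ramified place of the real signature: the shear is an element of `Real.ismDH` -/

variable {F : Type} [Field F] [NumberField F] (p : ℕ) [hp : Fact p.Prime]

/-- **At a place `v ∣ p` with `p > 2`, `e_v ≤ p − 2` and the analytic logarithm, the typed (Ind2) group `Real.ismDH logv (inr v)`
contains, for all `s, t ∈ K_v` with `p⁻¹ ≤ ‖s‖ < 1` and `p⁻¹ ≤ ‖t‖ < 1`, an element `g` with `g s = t` and `1 ≤ ‖g 1‖`** — a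
`ℤ_p`-lattice isomorphism of `I_v` (Dupuy–Hilado §4.9) read on c312-5's carrier, bicontinuous by finite-dimensionality.
[cite: DupuyHilado2025, §4.9] [cite: WeilBNT1967, Ch. II §2, Th. 1] [claim: Mochizuki2012, status: disputed] -/
theorem exists_mem_ismDH_map_eq {logv : PadicLogs F} (hlog : LogvAnalyticAt p logv)
    (v : HeightOneSpectrum (𝓞 F)) (hv : ((p : ℕ) : 𝓞 F) ∈ v.asIdeal) (hp2 : 2 < p)
    (he : absRamificationIdx p (RescaledCompletion F p v hv) ≤ p - 2)
    {s t : RescaledCompletion F p v hv} (hs : (p : ℝ)⁻¹ ≤ ‖s‖) (hs1 : ‖s‖ < 1)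
    (ht : (p : ℝ)⁻¹ ≤ ‖t‖) (ht1 : ‖t‖ < 1) :
    ∃ g ∈ ismDH logv (.inr v),
      g (ofR p v hv s) = ofR p v hv t ∧ 1 ≤ ‖toR p v hv (g (ofR p v hv 1))‖ := by
  haveI := finiteDimensional_rescaledCompletion p v hv
  obtain ⟨φ, hφΛ, hφs, hφ1⟩ :=
    exists_latticeAut_logUnits_map_eq_of_absRamificationIdx_le p (RescaledCompletion F p v hv) hp2 he hs hs1 ht ht1
  -- `φ` read on c312-5's carrier (the same type) as a `ℚ`-linear automorphism
  let g₀ : Carrier (.inr v : Place F) →+ Carrier (.inr v : Place F) := φ.toAddEquiv.toAddMonoidHom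
  let g : Carrier (.inr v : Place F) ≃ₗ[ℚ] Carrier (.inr v : Place F) :=
    { g₀.toRatLinearMap with
      invFun := φ.symm
      left_inv := φ.left_inv
      right_inv := φ.right_inv }
  have hφc : Continuous φ := φ.toLinearMap.continuous_of_finiteDimensional
  have hφc' : Continuous φ.symm := φ.symm.toLinearMap.continuous_of_finiteDimensional
  -- the log-shell of the real signature, read in the rescaled field, is `(p^*)⁻¹ • log_p(𝒪^×)`
  have hshell : (shell logv (.inr v) : Set (Carrier (.inr v : Place F))) =
      ((pStar p : ℕ) : ℚ_[p])⁻¹ • (logUnits (RescaledCompletion F p v hv) : Set (RescaledCompletion F p v hv)) :=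
    Set.ext fun a => mem_shell_iff_mem_smul_logUnits v hv hlog a
  refine ⟨g, ⟨hφc, hφc', ?_⟩, hφs, hφ1⟩
  rw [hshell]
  exact hφΛ _

/-- **Pilot-idele form.** For `t_q ∈ K_v` with `‖t_q‖ < 1` and `p⁻¹ ≤ ‖t_q^N‖`, `1 ≤ N` (print: `N = ℓ⋇²` and `t_q^N` the honest
Θ-idele of the TOP label, Dupuy–Hilado (3.4); the hypothesis says that Θ-idele is not more divisible than `p`), some
`g ∈ Real.ismDH logv (inr v)` maps `t_q^N ↦ t_q` and does not shrink `1`. This is the one-place ENGINE of the positive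
(shallow-ramified) side of the (xi-f) licence at the sharp real settings; the packet assembly is the consumer's.
[cite: DupuyHilado2025, §3.4, §4.9] [claim: Mochizuki2012, status: disputed] -/
theorem exists_mem_ismDH_map_pow_eq {logv : PadicLogs F} (hlog : LogvAnalyticAt p logv)
    (v : HeightOneSpectrum (𝓞 F)) (hv : ((p : ℕ) : 𝓞 F) ∈ v.asIdeal) (hp2 : 2 < p)
    (he : absRamificationIdx p (RescaledCompletion F p v hv) ≤ p - 2)
    {tq : RescaledCompletion F p v hv} (htq1 : ‖tq‖ < 1) {N : ℕ} (hN : 1 ≤ N)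
    (hdeep : (p : ℝ)⁻¹ ≤ ‖tq ^ N‖) :
    ∃ g ∈ ismDH logv (.inr v),
      g (ofR p v hv (tq ^ N)) = ofR p v hv tq ∧ 1 ≤ ‖toR p v hv (g (ofR p v hv 1))‖ := by
  have hle : ‖tq ^ N‖ ≤ ‖tq‖ := by
    rw [norm_pow]
    calc ‖tq‖ ^ N ≤ ‖tq‖ ^ 1 := pow_le_pow_of_le_one (norm_nonneg _) htq1.le hN
      _ = ‖tq‖ := pow_one _
  have hN0 : N ≠ 0 := by omega
  have hlt : ‖tq ^ N‖ < 1 := by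
    rw [norm_pow]
    exact pow_lt_one₀ (norm_nonneg _) htq1 hN0
  exact exists_mem_ismDH_map_eq p hlog v hv hp2 he hdeep hlt (hdeep.trans hle) htq1

end Real

end Thm311

end IUTFork

end Summit.ABC

end
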